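import Literature.NumberTheory.Transcendental.PadicNewtonInterpolation
import Mathlib.NumberTheory.Padics.PadicNumbers
import Mathlib.NumberTheory.Padics.PadicVal.Basic
import Mathlib.Data.Nat.Factorial.BigOperators
import HarnessLib

/-!
# Yu's `p`-adic extrapolation lemma (Yu 1989, Lemma 1.4) in Newton form: small jets at integer nodes

Theorems only (no definition, no named fact); sequel to `PadicNewtonInterpolation.lean`, whose
divided-difference operator `dd`, iterate `ddList`, weighted coefficient bounds `WtBdd ρ B b`
(`‖bₙ‖ ρⁿ ≤ B`) and Newton formula with remainder (`tsum_eq_newtonSum_add`) are used throughout.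

**The result.** Kunrui Yu, *Linear forms in p-adic logarithms*, Acta Arith. 53 (1989), Lemma 1.4
(p. 117) is the extrapolation device of the `p`-adic theory of linear forms in logarithms: if a
`p`-adic normal function `F` has SMALL (not necessarily vanishing) Taylor coefficients of order
`< M` at the points `s p^θ`, `1 ≤ s ≤ R`, `(s, q) = 1`, namely
`ord_p(F^{(t)}(sp^θ)/t!) + tθ ≥ (1 − 1/q)RMθ + M ord_p(R!) + (M − 1) log R/log p`, then
`ord_p F((l/q) p^θ) ≥ (1 − 1/q) RMθ` for every integer `l`. The two features that matter for the
numerics of Baker's method are (i) the GAIN `(1 − 1/q)RMθ` = (number of zeros with multiplicity) ×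
(depth `θ` of the points inside the disc of normality) and (ii) the CONDITIONING `M ord_p(R!)`,
of Legendre size `≈ MR/(p−1)`, paid because integer nodes are `p`-adically clustered.

Here it is proved in the radius-`ρ` normalisation of `PadicNewtonInterpolation.lean` (`G_b`
converging on `‖z‖ < ρ`, nodes in `‖z‖ ≤ r`, `r < ρ`, `r ≤ 1`; Yu's `F(z) = G(p^{−θ} z)`,
`ρ = p^θ`) and for nodes forming an ARITHMETIC PROGRESSION of integers `a_σ = eσ + f`, `p ∤ e`
(Yu's nodes for `q = 2` are the odd integers; consecutive integers are the case `e = 1`):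

* `norm_tsum_le_max_of_small_jets_blocks` — general complete ultrametric field, pairwise distinct
  nodes `a₀, …, a_{S−1}` in the disc, each of multiplicity `M`, ordered so that
  `∏_{τ'<τ} ‖a_σ − a_{τ'}‖ ≤ ∏_{τ'<τ} ‖a_τ − a_{τ'}‖` (`τ < σ`): if all jets of order `< M` at the
  nodes have norm `≤ ε` then `‖G_b(z)‖ ≤ max(ε · C, (B/ρ^{SM}) ∏_σ ‖z − a_σ‖^M)` for any `C`
  dominating the conditioning factors `∏_{τ<σ} ‖a_σ − a_τ‖^{−(2M−1)}`;
* `norm_tsum_le_max_of_small_jets_int`, `…_int'` — `K = ℚ_p`, nodes `eσ + f` (`σ < S`, `p ∤ e`):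
  `‖G_b(z)‖ ≤ max(ε · ‖(S−1)!‖_p^{−(2M−1)}, B/ρ^{SM})` for `‖z‖ ≤ 1`, with
  `‖(S−1)!‖_p^{−1} = p^{ord_p((S−1)!)}` — Yu's hypothesis/conclusion pair up to his explicit
  `(M−1) log R/log p`, which the Newton proof does not need.

**The proof** is by Newton interpolation with confluent nodes rather than Yu's explicit Hermite
interpolation formula (his Theorem A): the Newton coefficients along the grouped node list
`[a₀^M, a₁^M, …]` are jets of the successive divided differences, and the KEY STEP
(`norm_jet_iterate_le`) is that exhausting a node `c` (applying `dd c` `M` times) costs the jets of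
order `< M` at another node `a` at most a factor `‖a − c‖^{−(2M−1)}` — one division by `a − c` per
application (graded ultrametric induction on the two-point recursion
`t'_n = (t_n − t'_{n−1})/(a − c)`, `norm_jet_dd_le`), not one per coefficient. Along the ordered
nodes this accumulates to `∏_{τ<σ} ‖a_σ − a_τ‖^{−(2M−1)} = p^{(2M−1) ord_p(σ!)}` for consecutive
integers (`norm_jet_ddList_blocks_le`; the ordering hypothesis is binomial integrality). The crude
alternative — dividing by the minimal distance `δ` between distinct nodes at each of the `N − 1`
steps — would cost `δ^{−(N−1)} ≈ S^{SM}`, i.e. `log S` per zero instead of Legendre's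
`(2 log p)/(p−1)`; for the `p`-adic Cijsouw–Waldschmidt/Waldschmidt numerics (`S ≍ m W⋆` points)
only the Legendre form is affordable (cell abc-stewartyu, FLAG F-p1-1).

What is NOT here: Yu's general auxiliary prime `q` (nodes `(s, q) = 1` are not an arithmetic
progression for `q ≥ 3`), the points `s p^θ` with irrational `θ` (absorbed into `ρ`), and the
Taylor-series interface (jets are VALUES of iterated divided differences at the same point,
`G_{(dd a)ⁿ b}(a)`, which `PadicSmallJetsSchwarz.lean` identifies with Taylor coefficients).

## References

* [Yu1989] K. Yu, *Linear forms in p-adic logarithms*, Acta Arith. 53 (1989), 107–186 —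
  Lemma 1.4 (p. 117) and its proof (pp. 117–122).
* [Yu1990] K. Yu, *Linear forms in p-adic logarithms II*, Compositio Math. 74 (1990), §1
  (normal series, after Mahler), Lemma 1.2.
* [Robert2000PadicAnalysis] A. M. Robert, *A Course in p-adic Analysis*, GTM 198, Ch. 6 §2.
-/

noncomputable section

open Filter Topology IsUltrametricDist Finset

namespace Literature.NumberTheory.Transcendental

namespace PadicNewton


variable {K : Type*} [NontriviallyNormedField K] [IsUltrametricDist K] [CompleteSpace K]

/-! ### Iterated divided differences at one point (jets) -/

omit [IsUltrametricDist K] [CompleteSpace K] in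
/-- `ddList (replicate n a) b = (dd a)^[n] b`.
[cite: Yu1990, Lemma 1.2 (p-adic extrapolation for normal functions; Newton divided-difference form)] -/
theorem ddList_replicate (n : ℕ) (a : K) (b : ℕ → K) :
    ddList (List.replicate n a) b = (dd a)^[n] b := by
  induction n generalizing b with
  | zero => simp
  | succ n ih => rw [List.replicate_succ, ddList_cons, ih, Function.iterate_succ_apply]

omit [CompleteSpace K] in
/-- The iterate `(dd a)^[n] b` satisfies the weighted bound with `B/ρⁿ`.
[cite: Yu1990, §1 (normal series and functions, after Mahler)] -/
theorem wtBdd_iterate_dd {ρ B r : ℝ} (hρ : 0 < ρ) (hr : r ≤ ρ) {a : K} (ha : ‖a‖ ≤ r)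
    (n : ℕ) {b : ℕ → K} (hb : WtBdd ρ B b) : WtBdd ρ (B / ρ ^ n) ((dd a)^[n] b) := by
  rw [← ddList_replicate]
  have h := wtBdd_ddList hρ hr (List.replicate n a) hb (fun x hx => by
    rw [List.eq_of_mem_replicate hx]; exact ha)
  simpa using h

/-- Iterated divided differences at `a` commute with one at `c`:
`(dd a)^[n] (dd c b) = dd c ((dd a)^[n] b)`.
[cite: Robert2000PadicAnalysis, Ch. 6 §2 (zeros of power series; division by z − a)] -/
theorem iterate_dd_dd_comm {ρ B r : ℝ} (hρ : 0 < ρ) (hr : r < ρ) {a c : K} (ha : ‖a‖ ≤ r)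
    (hc : ‖c‖ ≤ r) : ∀ (n : ℕ) {b : ℕ → K}, WtBdd ρ B b →
      (dd a)^[n] (dd c b) = dd c ((dd a)^[n] b) := by
  intro n
  induction n generalizing B with
  | zero => intro b _; rfl
  | succ n ih =>
    intro b hb
    rw [Function.iterate_succ_apply, Function.iterate_succ_apply, dd_comm hb hρ hr ha hc]
    exact ih (wtBdd_dd hb hρ hr.le ha)

/-! ### Jets at `a` after a divided difference at another point `c` -/

/-- **The two-point recursion.** For `W` with the weighted bound and points `a ≠ c` in the disc,
put `Jₙ = G_{(dd a)ⁿ W}(a)` (the jets of `G_W` at `a`) and `uₙ = G_{(dd a)ⁿ W}(c)`. Then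
`uₙ = Jₙ + (c − a) u_{n+1}` (division identity) — stated as `u_{n+1} = (Jₙ − uₙ)/(a − c)`.
[cite: Yu1989, Lemma 1.4 (p. 117), proof] -/
theorem tsum_iterate_succ_eq_div {ρ B r : ℝ} (hρ : 0 < ρ) (hr : r < ρ) {a c : K} (ha : ‖a‖ ≤ r)
    (hc : ‖c‖ ≤ r) (hac : a ≠ c) {W : ℕ → K} (hW : WtBdd ρ B W) (n : ℕ) :
    ∑' m, ((dd a)^[n + 1] W) m * c ^ m =
      ((∑' m, ((dd a)^[n] W) m * a ^ m) - ∑' m, ((dd a)^[n] W) m * c ^ m) / (a - c) := by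
  have hWn : WtBdd ρ (B / ρ ^ n) ((dd a)^[n] W) := wtBdd_iterate_dd hρ hr.le ha n hW
  have h := tsum_eq_add_sub_mul_tsum_dd hWn hρ hr ha hc
  -- h : G_{W_n}(c) = G_{W_n}(a) + (c - a) * G_{dd a W_n}(c)
  rw [Function.iterate_succ_apply']
  have hac' : a - c ≠ 0 := sub_ne_zero.mpr hac
  field_simp
  linear_combination h

/-- **Jets after a divided difference at another point.** With `Jₙ, uₙ` as above and
`J'ₙ = G_{(dd a)ⁿ (dd c W)}(a)` the jets at `a` of the divided difference at `c`: `J'ₙ = u_{n+1}`.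
[cite: Yu1989, Lemma 1.4 (p. 117), proof] -/
theorem tsum_iterate_dd_eq {ρ B r : ℝ} (hρ : 0 < ρ) (hr : r < ρ) {a c : K} (ha : ‖a‖ ≤ r)
    (hc : ‖c‖ ≤ r) (hac : a ≠ c) {W : ℕ → K} (hW : WtBdd ρ B W) (n : ℕ) :
    ∑' m, ((dd a)^[n] (dd c W)) m * a ^ m = ∑' m, ((dd a)^[n + 1] W) m * c ^ m := by
  rw [iterate_dd_dd_comm hρ hr ha hc n hW, tsum_iterate_succ_eq_div hρ hr ha hc hac hW n]
  have hWn : WtBdd ρ (B / ρ ^ n) ((dd a)^[n] W) := wtBdd_iterate_dd hρ hr.le ha n hW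
  -- division identity between `c` and `a` for `W_n`: G(a) = G(c) + (a - c) G_{dd c W_n}(a)
  have h := tsum_eq_add_sub_mul_tsum_dd hWn hρ hr hc ha
  have hac' : a - c ≠ 0 := sub_ne_zero.mpr hac
  field_simp
  linear_combination -h

/-- **Graded jet bound under one divided difference at another point.** If `‖G_W(c)‖ ≤ X` and
`‖Jₙ‖ · ‖a − c‖ⁿ ≤ X` for `n < M`, then `‖J'ₙ‖ · ‖a − c‖^{n+1} ≤ X` for `n < M` (ultrametric
induction on the two-point recursion: one division by `a − c` per application, not per jet).
[cite: Yu1989, Lemma 1.4 (p. 117), proof] -/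
theorem norm_jet_dd_le {ρ B r : ℝ} (hρ : 0 < ρ) (hr : r < ρ) {a c : K} (ha : ‖a‖ ≤ r)
    (hc : ‖c‖ ≤ r) (hac : a ≠ c) {W : ℕ → K} (hW : WtBdd ρ B W) {M : ℕ} {X : ℝ}
    (h0 : ‖∑' m, W m * c ^ m‖ ≤ X)
    (hJ : ∀ n < M, ‖∑' m, ((dd a)^[n] W) m * a ^ m‖ * ‖a - c‖ ^ n ≤ X) :
    ∀ n < M, ‖∑' m, ((dd a)^[n] (dd c W)) m * a ^ m‖ * ‖a - c‖ ^ (n + 1) ≤ X := by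
  have hD : 0 < ‖a - c‖ := norm_pos_iff.mpr (sub_ne_zero.mpr hac)
  -- the auxiliary values `uₙ = G_{W_n}(c)` and their graded bound
  have hu : ∀ n ≤ M, ‖∑' m, ((dd a)^[n] W) m * c ^ m‖ * ‖a - c‖ ^ n ≤ X := by
    intro n
    induction n with
    | zero => intro _; simpa using h0
    | succ n ih =>
      intro hn
      rw [tsum_iterate_succ_eq_div hρ hr ha hc hac hW n, norm_div, pow_succ]
      have h1 := ih (by omega)
      have h2 := hJ n (by omega)
      have h3 : ‖(∑' m, ((dd a)^[n] W) m * a ^ m) - ∑' m, ((dd a)^[n] W) m * c ^ m‖ ≤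
          max ‖∑' m, ((dd a)^[n] W) m * a ^ m‖ ‖∑' m, ((dd a)^[n] W) m * c ^ m‖ := by
        have := norm_add_le_max (∑' m, ((dd a)^[n] W) m * a ^ m) (-∑' m, ((dd a)^[n] W) m * c ^ m)
        rwa [norm_neg, ← sub_eq_add_neg] at this
      calc ‖(∑' m, (dd a)^[n] W m * a ^ m) - ∑' m, (dd a)^[n] W m * c ^ m‖ / ‖a - c‖ *
            (‖a - c‖ ^ n * ‖a - c‖)
          = ‖(∑' m, (dd a)^[n] W m * a ^ m) - ∑' m, (dd a)^[n] W m * c ^ m‖ * ‖a - c‖ ^ n := by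
            field_simp
        _ ≤ max ‖∑' m, ((dd a)^[n] W) m * a ^ m‖ ‖∑' m, ((dd a)^[n] W) m * c ^ m‖ *
            ‖a - c‖ ^ n := mul_le_mul_of_nonneg_right h3 (by positivity)
        _ ≤ X := by
            rcases le_total ‖∑' m, ((dd a)^[n] W) m * a ^ m‖ ‖∑' m, ((dd a)^[n] W) m * c ^ m‖
              with h | h
            · rw [max_eq_right h]; exact h1
            · rw [max_eq_left h]; exact h2
  intro n hn
  rw [tsum_iterate_dd_eq hρ hr ha hc hac hW n]
  exact hu (n + 1) (by omega)

/-- **KEY STEP: jets at `a` after exhausting the node `c` (`M` divided differences at `c`).**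
If all jets of order `< M` of `G_W` at `a` and at `c` have norm `≤ Z`, and `‖a − c‖ ≤ 1`, then the
jets of order `< M` at `a` of `G_{(dd c)^M W}` have norm `≤ Z / ‖a − c‖^{2M−1}`.
[cite: Yu1989, Lemma 1.4 (p. 117), proof] -/
theorem norm_jet_iterate_le {ρ B r : ℝ} (hρ : 0 < ρ) (hr : r < ρ) {a c : K} (ha : ‖a‖ ≤ r)
    (hc : ‖c‖ ≤ r) (hac : a ≠ c) (hD1 : ‖a - c‖ ≤ 1) {W : ℕ → K} (hW : WtBdd ρ B W) {M : ℕ}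
    {Z : ℝ} (hZ : 0 ≤ Z)
    (hJa : ∀ n < M, ‖∑' m, ((dd a)^[n] W) m * a ^ m‖ ≤ Z)
    (hJc : ∀ k < M, ‖∑' m, ((dd c)^[k] W) m * c ^ m‖ ≤ Z) :
    ∀ n < M, ‖∑' m, ((dd a)^[n] ((dd c)^[M] W)) m * a ^ m‖ * ‖a - c‖ ^ (2 * M - 1) ≤ Z := by
  have hD : 0 < ‖a - c‖ := norm_pos_iff.mpr (sub_ne_zero.mpr hac)
  -- invariant after `k ≤ M` steps: `‖J(W_k, a, n)‖ · D^{n+k} ≤ Z`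
  have inv : ∀ k ≤ M, ∀ n < M,
      ‖∑' m, ((dd a)^[n] ((dd c)^[k] W)) m * a ^ m‖ * ‖a - c‖ ^ (n + k) ≤ Z := by
    intro k
    induction k with
    | zero =>
      intro _ n hn
      simp only [Function.iterate_zero, id_eq, add_zero]
      calc ‖∑' m, (dd a)^[n] W m * a ^ m‖ * ‖a - c‖ ^ n
          ≤ Z * 1 := mul_le_mul (hJa n hn) (pow_le_one₀ hD.le hD1) (by positivity) hZ
        _ = Z := mul_one Z
    | succ k ih =>
      intro hk n hn
      have hWk : WtBdd ρ (B / ρ ^ k) ((dd c)^[k] W) := wtBdd_iterate_dd hρ hr.le hc k hW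
      -- the value subtracted at this step is the `k`-th jet at `c`
      have h0 : ‖∑' m, ((dd c)^[k] W) m * c ^ m‖ ≤ Z / ‖a - c‖ ^ k := by
        rw [le_div_iff₀ (pow_pos hD k)]
        calc ‖∑' m, (dd c)^[k] W m * c ^ m‖ * ‖a - c‖ ^ k ≤ Z * 1 :=
              mul_le_mul (hJc k (by omega)) (pow_le_one₀ hD.le hD1) (by positivity) hZ
          _ = Z := mul_one Z
      have hJ' : ∀ n < M, ‖∑' m, ((dd a)^[n] ((dd c)^[k] W)) m * a ^ m‖ * ‖a - c‖ ^ n ≤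
          Z / ‖a - c‖ ^ k := by
        intro n' hn'
        rw [le_div_iff₀ (pow_pos hD k), mul_assoc, ← pow_add]
        exact ih (by omega) n' hn'
      have h := norm_jet_dd_le hρ hr ha hc hac hWk h0 hJ' n hn
      rw [Function.iterate_succ_apply']
      rw [le_div_iff₀ (pow_pos hD k), mul_assoc, ← pow_add] at h
      rwa [show n + (k + 1) = n + 1 + k by ring]
  intro n hn
  have h := inv M le_rfl n hn
  -- `D^{2M-1} ≤ D^{n+M}` since `n + M ≤ 2M - 1` and `D ≤ 1`
  calc ‖∑' m, (dd a)^[n] ((dd c)^[M] W) m * a ^ m‖ * ‖a - c‖ ^ (2 * M - 1)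
      ≤ ‖∑' m, (dd a)^[n] ((dd c)^[M] W) m * a ^ m‖ * ‖a - c‖ ^ (n + M) :=
        mul_le_mul_of_nonneg_left (pow_le_pow_of_le_one hD.le hD1 (by omega)) (norm_nonneg _)
    _ ≤ Z := h



/-! ### Grouped node lists `[a₀^M, a₁^M, …]` -/

omit [IsUltrametricDist K] [CompleteSpace K] in
/-- `ddList (xs ++ ys) b = ddList ys (ddList xs b)`.
[cite: Yu1990, Lemma 1.2 (p-adic extrapolation for normal functions; Newton divided-difference form)] -/
theorem ddList_append (xs ys : List K) (b : ℕ → K) :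
    ddList (xs ++ ys) b = ddList ys (ddList xs b) := by
  simp [ddList, List.foldl_append]

omit [NontriviallyNormedField K] [IsUltrametricDist K] [CompleteSpace K] in
/-- The grouped node list with one more block: `blocks(τ, n+1) = a_τ^M ++ blocks(τ+1, n)`.
[folklore] -/
private theorem flatMap_range'_succ (a : ℕ → K) (M τ n : ℕ) :
    ((List.range' τ (n + 1)).flatMap fun σ => List.replicate M (a σ)) =
      List.replicate M (a τ) ++ (List.range' (τ + 1) n).flatMap fun σ => List.replicate M (a σ) := by
  rw [List.range'_succ, List.flatMap_cons]

omit [NontriviallyNormedField K] [IsUltrametricDist K] [CompleteSpace K] in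
/-- The grouped node list with one more block at the end:
`blocks(τ, n+1) = blocks(τ, n) ++ a_{τ+n}^M`. [folklore] -/
private theorem flatMap_range'_succ_right (a : ℕ → K) (M τ n : ℕ) :
    ((List.range' τ (n + 1)).flatMap fun σ => List.replicate M (a σ)) =
      ((List.range' τ n).flatMap fun σ => List.replicate M (a σ)) ++ List.replicate M (a (τ + n)) := by
  rw [List.range'_concat, List.flatMap_append]
  simp

omit [NontriviallyNormedField K] [IsUltrametricDist K] [CompleteSpace K] in
/-- Membership in a grouped node list. [folklore] -/
private theorem mem_flatMap_range' {a : ℕ → K} {M τ n : ℕ} {x : K}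
    (hx : x ∈ (List.range' τ n).flatMap fun σ => List.replicate M (a σ)) :
    ∃ σ, τ ≤ σ ∧ σ < τ + n ∧ x = a σ := by
  rw [List.mem_flatMap] at hx
  obtain ⟨σ, hσ, hxσ⟩ := hx
  rw [List.mem_range'_1] at hσ
  exact ⟨σ, hσ.1, hσ.2, List.eq_of_mem_replicate hxσ⟩

omit [NontriviallyNormedField K] [IsUltrametricDist K] [CompleteSpace K] in
/-- Length of a grouped node list: `n · M`. [folklore] -/
private theorem length_flatMap_range' (a : ℕ → K) (M τ n : ℕ) :
    ((List.range' τ n).flatMap fun σ => List.replicate M (a σ)).length = n * M := by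
  induction n generalizing τ with
  | zero => simp
  | succ n ih => rw [flatMap_range'_succ, List.length_append, List.length_replicate, ih]; ring

omit [IsUltrametricDist K] [CompleteSpace K] in
/-- The Newton basis product over a grouped node list: `∏_σ (z − a_σ)^M`. [folklore] -/
private theorem prod_map_flatMap_range' (a : ℕ → K) (M : ℕ) (z : K) (n : ℕ) : ∀ τ : ℕ,
    (((List.range' τ n).flatMap fun σ => List.replicate M (a σ)).map fun x => z - x).prod =
      ∏ i ∈ Finset.range n, (z - a (τ + i)) ^ M := by
  induction n with
  | zero => intro τ; simp
  | succ n ih =>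
    intro τ
    rw [flatMap_range'_succ_right, List.map_append, List.prod_append, ih τ,
      Finset.prod_range_succ, List.map_replicate, List.prod_replicate]

/-! ### The Newton sum over a grouped node list -/

omit [IsUltrametricDist K] [CompleteSpace K] in
/-- **Block recursion of the Newton sum**: over `a^M ++ rest`,
`N(a^M ++ rest, W, z) = ∑_{k<M} G_{(dd a)ᵏ W}(a) (z − a)ᵏ + (z − a)^M · N(rest, (dd a)^M W, z)`.
[cite: Yu1989, Lemma 1.4 (p. 117), proof] -/
theorem newtonSum_replicate_append (c : K) (rest : List K) (z : K) :
    ∀ (M : ℕ) (W : ℕ → K), newtonSum (List.replicate M c ++ rest) W z =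
      (∑ k ∈ Finset.range M, (∑' m, ((dd c)^[k] W) m * c ^ m) * (z - c) ^ k) +
        (z - c) ^ M * newtonSum rest ((dd c)^[M] W) z := by
  intro M
  induction M with
  | zero => intro W; simp
  | succ M ih =>
    intro W
    rw [List.replicate_succ, List.cons_append, newtonSum_cons, ih (dd c W),
      Finset.sum_range_succ' ]
    simp only [Function.iterate_succ_apply, Function.iterate_zero, id_eq, pow_zero, mul_one,
      pow_succ]
    rw [mul_add, Finset.mul_sum]
    have : ∀ k ∈ Finset.range M, (z - c) * ((∑' m, (dd c)^[k] (dd c W) m * c ^ m) * (z - c) ^ k)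
        = (∑' m, (dd c)^[k] (dd c W) m * c ^ m) * ((z - c) ^ k * (z - c)) := by
      intro k _; ring
    rw [Finset.sum_congr rfl this]
    ring

omit [CompleteSpace K] in
/-- Ultrametric inequality for differences. [folklore] -/
private theorem norm_sub_le_max' (x y : K) : ‖x - y‖ ≤ max ‖x‖ ‖y‖ := by
  have := norm_add_le_max x (-y)
  rwa [norm_neg, ← sub_eq_add_neg] at this

omit [CompleteSpace K] in
/-- **Block bound**: if all jets at `c` of order `< M` of `G_W` have norm `≤ Y`, `‖z − c‖ ≤ 1`,
and the Newton sum of the rest (for `(dd c)^M W`) has norm `≤ Y`, then so does the whole Newton sum.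
[cite: Yu1989, Lemma 1.4 (p. 117), proof] -/
theorem norm_newtonSum_replicate_append_le {c : K} {rest : List K} {z : K} {M : ℕ} {W : ℕ → K}
    {Y : ℝ} (hY : 0 ≤ Y) (hzc : ‖z - c‖ ≤ 1)
    (hJ : ∀ k < M, ‖∑' m, ((dd c)^[k] W) m * c ^ m‖ ≤ Y)
    (hrest : ‖newtonSum rest ((dd c)^[M] W) z‖ ≤ Y) :
    ‖newtonSum (List.replicate M c ++ rest) W z‖ ≤ Y := by
  rw [newtonSum_replicate_append]
  have h1 : ‖∑ k ∈ Finset.range M, (∑' m, ((dd c)^[k] W) m * c ^ m) * (z - c) ^ k‖ ≤ Y := by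
    refine IsUltrametricDist.norm_sum_le_of_forall_le_of_nonneg hY fun k hk => ?_
    rw [Finset.mem_range] at hk
    rw [norm_mul, norm_pow]
    calc ‖∑' m, (dd c)^[k] W m * c ^ m‖ * ‖z - c‖ ^ k ≤ Y * 1 :=
          mul_le_mul (hJ k hk) (pow_le_one₀ (norm_nonneg _) hzc) (by positivity) hY
      _ = Y := mul_one Y
  have h2 : ‖(z - c) ^ M * newtonSum rest ((dd c)^[M] W) z‖ ≤ Y := by
    rw [norm_mul, norm_pow]
    calc ‖z - c‖ ^ M * ‖newtonSum rest ((dd c)^[M] W) z‖ ≤ 1 * Y :=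
          mul_le_mul (pow_le_one₀ (norm_nonneg _) hzc) hrest (norm_nonneg _) zero_le_one
      _ = Y := one_mul Y
  exact (norm_add_le_max _ _).trans (max_le h1 h2)

/-! ### The extrapolation lemma for grouped nodes (Yu 1989, Lemma 1.4, Newton form) -/

/-- **Propagation of small jets** (the heart of Yu's extrapolation lemma). Nodes `a₀, …, a_{S−1}`
pairwise distinct in the disc `‖·‖ ≤ r ≤ 1`, ordered so that
`∏_{τ'<τ} ‖a_σ − a_{τ'}‖ ≤ ∏_{τ'<τ} ‖a_τ − a_{τ'}‖` for `τ < σ` (hypothesis (H); for integer nodes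
in increasing order this is the integrality of binomial coefficients); `G_b` with the weighted bound;
all jets of order `< M` at all nodes of norm `≤ ε`. Then after exhausting the first `τ` nodes
(`H_τ = ddList [a₀^M, …, a_{τ−1}^M] b`) the jets of order `< M` at a later node `a_σ` have norm
`≤ ε / ∏_{τ'<τ} ‖a_σ − a_{τ'}‖^{2M−1}`. [cite: Yu1989, Lemma 1.4 (p. 117), proof] -/
theorem norm_jet_ddList_blocks_le {ρ B r ε : ℝ} (hρ : 0 < ρ) (hr : r < ρ) (hr1 : r ≤ 1)
    (hε : 0 ≤ ε) {b : ℕ → K} (hb : WtBdd ρ B b) {S M : ℕ} {a : ℕ → K}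
    (ha : ∀ σ < S, ‖a σ‖ ≤ r) (hinj : ∀ σ < S, ∀ τ < S, σ ≠ τ → a σ ≠ a τ)
    (hH : ∀ τ σ, τ < σ → σ < S →
      ∏ τ' ∈ Finset.range τ, ‖a σ - a τ'‖ ≤ ∏ τ' ∈ Finset.range τ, ‖a τ - a τ'‖)
    (hjet : ∀ σ < S, ∀ n < M, ‖∑' m, ((dd (a σ))^[n] b) m * (a σ) ^ m‖ ≤ ε) :
    ∀ τ ≤ S, ∀ σ, τ ≤ σ → σ < S → ∀ n < M,
      ‖∑' m, ((dd (a σ))^[n]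
          (ddList ((List.range' 0 τ).flatMap fun σ => List.replicate M (a σ)) b)) m * (a σ) ^ m‖ *
        ∏ τ' ∈ Finset.range τ, ‖a σ - a τ'‖ ^ (2 * M - 1) ≤ ε := by
  intro τ
  induction τ with
  | zero =>
    intro _ σ _ hσ n hn
    simpa using hjet σ hσ n hn
  | succ τ ih =>
    intro hτ σ hτσ hσ n hn
    have hτS : τ < S := by omega
    -- the stage-τ sequence and its weighted bound
    set L : List K := (List.range' 0 τ).flatMap fun σ => List.replicate M (a σ) with hL
    set H : ℕ → K := ddList L b with hHdef
    have hLmem : ∀ x ∈ L, ‖x‖ ≤ r := by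
      intro x hx
      obtain ⟨σ', -, hσ', rfl⟩ := mem_flatMap_range' hx
      exact ha σ' (by omega)
    have hHB : WtBdd ρ (B / ρ ^ L.length) H := wtBdd_ddList hρ hr.le L hb hLmem
    -- the stage-(τ+1) sequence is `(dd a_τ)^M H`
    have hstep : ddList ((List.range' 0 (τ + 1)).flatMap fun σ => List.replicate M (a σ)) b =
        (dd (a τ))^[M] H := by
      rw [flatMap_range'_succ_right, ddList_append, ← hL, ← hHdef, ddList_replicate, zero_add]
    rw [hstep]
    -- distances
    have hne : a σ ≠ a τ := hinj σ hσ τ hτS (by omega)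
    have hD : 0 < ‖a σ - a τ‖ := norm_pos_iff.mpr (sub_ne_zero.mpr hne)
    have hD1 : ‖a σ - a τ‖ ≤ 1 :=
      ((norm_sub_le_max' _ _).trans (max_le ((ha σ hσ).trans hr1) ((ha τ hτS).trans hr1)))
    have hprodpos : ∀ σ', σ' < S → τ ≤ σ' → 0 < ∏ τ' ∈ Finset.range τ, ‖a σ' - a τ'‖ := by
      intro σ' hσ' hτσ'
      refine Finset.prod_pos fun τ' hτ' => norm_pos_iff.mpr (sub_ne_zero.mpr ?_)
      rw [Finset.mem_range] at hτ'
      exact hinj σ' hσ' τ' (by omega) (by omega)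
    -- `Z = ε / ∏_{τ'<τ} ‖a_σ − a_τ'‖^{2M−1}` bounds the jets of `H` at `a_σ` and at `a_τ`
    set Pσ : ℝ := ∏ τ' ∈ Finset.range τ, ‖a σ - a τ'‖ ^ (2 * M - 1) with hPσ
    set Pτ : ℝ := ∏ τ' ∈ Finset.range τ, ‖a τ - a τ'‖ ^ (2 * M - 1) with hPτ
    have hPσpos : 0 < Pσ := Finset.prod_pos fun τ' hτ' => pow_pos (by
      rw [Finset.mem_range] at hτ'
      exact norm_pos_iff.mpr (sub_ne_zero.mpr (hinj σ hσ τ' (by omega) (by omega)))) _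
    have hPτpos : 0 < Pτ := Finset.prod_pos fun τ' hτ' => pow_pos (by
      rw [Finset.mem_range] at hτ'
      exact norm_pos_iff.mpr (sub_ne_zero.mpr (hinj τ hτS τ' (by omega) (by omega)))) _
    have hPle : Pσ ≤ Pτ := by
      rw [hPσ, hPτ, Finset.prod_pow, Finset.prod_pow]
      exact pow_le_pow_left₀ (Finset.prod_nonneg fun _ _ => norm_nonneg _)
        (hH τ σ (by omega) hσ) _
    set Z : ℝ := ε / Pσ with hZ
    have hZ0 : 0 ≤ Z := div_nonneg hε hPσpos.le
    have hJa : ∀ n < M, ‖∑' m, ((dd (a σ))^[n] H) m * (a σ) ^ m‖ ≤ Z := by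
      intro n' hn'
      rw [hZ, le_div_iff₀ hPσpos]
      exact ih (by omega) σ (by omega) hσ n' hn'
    have hJc : ∀ k < M, ‖∑' m, ((dd (a τ))^[k] H) m * (a τ) ^ m‖ ≤ Z := by
      intro k hk
      have h1 := ih (by omega) τ le_rfl hτS k hk
      rw [hZ, le_div_iff₀ hPσpos]
      exact (mul_le_mul_of_nonneg_left hPle (norm_nonneg _)).trans h1
    have key := norm_jet_iterate_le hρ hr (ha σ hσ) (ha τ hτS) hne hD1 hHB hZ0 hJa hJc n hn
    -- `∏_{τ'<τ+1} = Pσ · ‖a_σ − a_τ‖^{2M−1}`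
    rw [Finset.prod_range_succ, ← hPσ]
    calc ‖∑' m, (dd (a σ))^[n] ((dd (a τ))^[M] H) m * a σ ^ m‖ * (Pσ * ‖a σ - a τ‖ ^ (2 * M - 1))
        = (‖∑' m, (dd (a σ))^[n] ((dd (a τ))^[M] H) m * a σ ^ m‖ * ‖a σ - a τ‖ ^ (2 * M - 1)) *
            Pσ := by ring
      _ ≤ Z * Pσ := mul_le_mul_of_nonneg_right key hPσpos.le
      _ = ε := by rw [hZ]; field_simp



/-- **Bound for the Newton sum over the grouped node list** (all Newton coefficients are jets at
the nodes of the successive stages, bounded by `norm_jet_ddList_blocks_le`).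
[cite: Yu1989, Lemma 1.4 (p. 117), proof] -/
theorem norm_newtonSum_blocks_le {ρ B r ε : ℝ} (hρ : 0 < ρ) (hr : r < ρ) (hr1 : r ≤ 1)
    (hε : 0 ≤ ε) {b : ℕ → K} (hb : WtBdd ρ B b) {S M : ℕ} {a : ℕ → K}
    (ha : ∀ σ < S, ‖a σ‖ ≤ r) (hinj : ∀ σ < S, ∀ τ < S, σ ≠ τ → a σ ≠ a τ)
    (hH : ∀ τ σ, τ < σ → σ < S →
      ∏ τ' ∈ Finset.range τ, ‖a σ - a τ'‖ ≤ ∏ τ' ∈ Finset.range τ, ‖a τ - a τ'‖)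
    (hjet : ∀ σ < S, ∀ n < M, ‖∑' m, ((dd (a σ))^[n] b) m * (a σ) ^ m‖ ≤ ε)
    {C : ℝ} (hC0 : 0 ≤ C)
    (hC : ∀ σ < S, (∏ τ' ∈ Finset.range σ, ‖a σ - a τ'‖ ^ (2 * M - 1))⁻¹ ≤ C)
    {z : K} (hz : ‖z‖ ≤ r) :
    ∀ n τ, τ + n = S →
      ‖newtonSum ((List.range' τ n).flatMap fun σ => List.replicate M (a σ))
          (ddList ((List.range' 0 τ).flatMap fun σ => List.replicate M (a σ)) b) z‖ ≤ ε * C := by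
  intro n
  induction n with
  | zero => intro τ _; simp; positivity
  | succ n ih =>
    intro τ hτ
    have hτS : τ < S := by omega
    rw [flatMap_range'_succ]
    have hstep : ddList ((List.range' 0 (τ + 1)).flatMap fun σ => List.replicate M (a σ)) b =
        (dd (a τ))^[M] (ddList ((List.range' 0 τ).flatMap fun σ => List.replicate M (a σ)) b) := by
      rw [flatMap_range'_succ_right, ddList_append, ddList_replicate, zero_add]
    have hzc : ‖z - a τ‖ ≤ 1 := by
      have := norm_add_le_max z (-(a τ))
      rw [norm_neg, ← sub_eq_add_neg] at this
      exact this.trans (max_le (hz.trans hr1) ((ha τ hτS).trans hr1))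
    refine norm_newtonSum_replicate_append_le (mul_nonneg hε hC0) hzc ?_ ?_
    · -- the jets of the stage-τ sequence at `a_τ`
      intro k hk
      have h := norm_jet_ddList_blocks_le hρ hr hr1 hε hb ha hinj hH hjet τ hτS.le τ le_rfl hτS k hk
      have hPpos : 0 < ∏ τ' ∈ Finset.range τ, ‖a τ - a τ'‖ ^ (2 * M - 1) :=
        Finset.prod_pos fun τ' hτ' => pow_pos (by
          rw [Finset.mem_range] at hτ'
          exact norm_pos_iff.mpr (sub_ne_zero.mpr (hinj τ hτS τ' (by omega) (by omega)))) _
      have h2 := hC τ hτS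
      calc ‖∑' m, (dd (a τ))^[k]
              (ddList ((List.range' 0 τ).flatMap fun σ => List.replicate M (a σ)) b) m * a τ ^ m‖
          = ‖∑' m, (dd (a τ))^[k]
              (ddList ((List.range' 0 τ).flatMap fun σ => List.replicate M (a σ)) b) m * a τ ^ m‖ *
              (∏ τ' ∈ Finset.range τ, ‖a τ - a τ'‖ ^ (2 * M - 1)) *
              (∏ τ' ∈ Finset.range τ, ‖a τ - a τ'‖ ^ (2 * M - 1))⁻¹ := by
            field_simp
        _ ≤ ε * C := mul_le_mul h h2 (by positivity) hε
    · rw [← hstep]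
      exact ih (τ + 1) (by omega)

/-- **Yu's extrapolation lemma, Newton form (small jets at grouped nodes ⟹ small values).**
Let `G_b` satisfy the weighted bound `‖bₙ‖ρⁿ ≤ B`, and let `a₀, …, a_{S−1}` be pairwise distinct
nodes in the disc `‖·‖ ≤ r` (`r < ρ`, `r ≤ 1`), ordered so that
`∏_{τ'<τ} ‖a_σ − a_{τ'}‖ ≤ ∏_{τ'<τ} ‖a_τ − a_{τ'}‖` for `τ < σ` (for an increasing arithmetic
progression of integers with difference prime to `p` this is the integrality of binomial
coefficients). If all jets (Taylor coefficients, = values of the iterated divided differences) of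
order `< M` of `G_b` at the nodes have norm `≤ ε`, then for every `z` in the disc
`‖G_b(z)‖ ≤ max(ε · C, (B/ρ^{SM}) · ∏_σ ‖z − a_σ‖^M)` for any `C` dominating the conditioning
factors `∏_{τ<σ} ‖a_σ − a_τ‖^{−(2M−1)}` (`= p^{(2M−1) ord_p(σ!)}` for consecutive integers). This is
Lemma 1.4 of Yu (1989) — there for the nodes `s p^θ`, `(s, q) = 1`, in Mahler's normalisation and
proved by an explicit Hermite interpolation formula — in the radius-`ρ` normalisation of
`PadicNewtonInterpolation.lean` and proved by Newton interpolation with confluent nodes: the jets at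
a later node lose a factor `‖a_σ − a_τ‖^{2M−1}` when the node `a_τ` is exhausted
(`norm_jet_iterate_le`), which replaces the crude `δ^{−(N−1)}` of a minimal-distance argument by
Yu's factorial (Legendre) conditioning `M · ord_p(R!)`.
[cite: Yu1989, Lemma 1.4 (p. 117)] -/
theorem norm_tsum_le_max_of_small_jets_blocks {ρ B r ε : ℝ} (hρ : 0 < ρ) (hr : r < ρ)
    (hr1 : r ≤ 1) (hε : 0 ≤ ε) {b : ℕ → K} (hb : WtBdd ρ B b) {S M : ℕ} {a : ℕ → K}
    (ha : ∀ σ < S, ‖a σ‖ ≤ r) (hinj : ∀ σ < S, ∀ τ < S, σ ≠ τ → a σ ≠ a τ)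
    (hH : ∀ τ σ, τ < σ → σ < S →
      ∏ τ' ∈ Finset.range τ, ‖a σ - a τ'‖ ≤ ∏ τ' ∈ Finset.range τ, ‖a τ - a τ'‖)
    (hjet : ∀ σ < S, ∀ n < M, ‖∑' m, ((dd (a σ))^[n] b) m * (a σ) ^ m‖ ≤ ε)
    {C : ℝ} (hC0 : 0 ≤ C)
    (hC : ∀ σ < S, (∏ τ' ∈ Finset.range σ, ‖a σ - a τ'‖ ^ (2 * M - 1))⁻¹ ≤ C)
    {z : K} (hz : ‖z‖ ≤ r) :
    ‖∑' m, b m * z ^ m‖ ≤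
      max (ε * C) (B / ρ ^ (S * M) * ∏ σ ∈ Finset.range S, ‖z - a σ‖ ^ M) := by
  set L : List K := (List.range' 0 S).flatMap fun σ => List.replicate M (a σ) with hL
  have hLmem : ∀ x ∈ L, ‖x‖ ≤ r := by
    intro x hx
    obtain ⟨σ', -, hσ', rfl⟩ := mem_flatMap_range' hx
    exact ha σ' (by omega)
  have hnewton := tsum_eq_newtonSum_add hρ hr L hb hLmem hz
  have hNS : ‖newtonSum L b z‖ ≤ ε * C := by
    have h := norm_newtonSum_blocks_le hρ hr hr1 hε hb ha hinj hH hjet hC0 hC hz S 0 (zero_add S)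
    simpa using h
  have hrem : ‖(L.map fun x => z - x).prod * ∑' n, ddList L b n * z ^ n‖ ≤
      B / ρ ^ (S * M) * ∏ σ ∈ Finset.range S, ‖z - a σ‖ ^ M := by
    rw [norm_mul, hL, prod_map_flatMap_range', norm_prod]
    simp only [zero_add, norm_pow]
    have hB : ‖∑' n, ddList L b n * z ^ n‖ ≤ B / ρ ^ (S * M) := by
      have h := (wtBdd_ddList hρ hr.le L hb hLmem).norm_tsum_le hρ hr.le hz
      rwa [hL, length_flatMap_range'] at h
    rw [mul_comm]
    exact mul_le_mul_of_nonneg_right hB (Finset.prod_nonneg fun _ _ => by positivity)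
  rw [hnewton]
  exact (norm_add_le_max _ _).trans (max_le_max hNS hrem)


open Padic

/-! ### Integer nodes in `ℚ_p`: Yu's Lemma 1.4 -/

/-- Norm of an integer prime to `p` in `ℚ_p` is `1`. [folklore] -/
private theorem padic_norm_intCast_eq_one {p : ℕ} [Fact p.Prime] {e : ℤ} (he : ¬ (p : ℤ) ∣ e) :
    ‖(e : ℚ_[p])‖ = 1 :=
  le_antisymm (norm_int_le_one e) (not_lt.mp fun h => he (norm_intCast_lt_one_iff.mp h))

/-- Divisibility decreases the `p`-adic norm of natural numbers: `m ∣ n ⇒ ‖n‖_p ≤ ‖m‖_p`.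
[folklore] -/
private theorem padic_norm_natCast_le_of_dvd {p : ℕ} [Fact p.Prime] {m n : ℕ} (h : m ∣ n) :
    ‖(n : ℚ_[p])‖ ≤ ‖(m : ℚ_[p])‖ := by
  obtain ⟨k, rfl⟩ := h
  push_cast
  rw [norm_mul]
  calc ‖(m : ℚ_[p])‖ * ‖(k : ℚ_[p])‖ ≤ ‖(m : ℚ_[p])‖ * 1 :=
        mul_le_mul_of_nonneg_left (by exact_mod_cast norm_int_le_one (k : ℤ)) (norm_nonneg _)
    _ = ‖(m : ℚ_[p])‖ := mul_one _

/-- The `p`-adic norm of `n!` is `p^{−ord_p(n!)}`, i.e. `‖n!‖_p⁻¹ = p^{ord_p(n!)}`. [folklore] -/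
private theorem inv_padic_norm_factorial {p : ℕ} [Fact p.Prime] (n : ℕ) :
    ‖((n.factorial : ℕ) : ℚ_[p])‖⁻¹ = (p : ℝ) ^ padicValNat p n.factorial := by
  have h0 : (n.factorial : ℚ) ≠ 0 := by exact_mod_cast n.factorial_ne_zero
  rw [show ((n.factorial : ℕ) : ℚ_[p]) = ((n.factorial : ℚ) : ℚ_[p]) by norm_cast, eq_padicNorm,
    padicNorm.eq_zpow_of_nonzero h0, padicValRat.of_nat, zpow_neg, Rat.cast_inv, inv_inv,
    zpow_natCast, Rat.cast_pow, Rat.cast_natCast]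

/-- Products of differences along an arithmetic progression `a_σ = eσ + f` (`p ∤ e`):
`∏_{τ<k} ‖a_σ − a_τ‖_p = ‖σ(σ−1)⋯(σ−k+1)‖_p` for `k ≤ σ`. [folklore] -/
private theorem prod_norm_sub_ap {p : ℕ} [Fact p.Prime] {e f : ℤ} (he : ¬ (p : ℤ) ∣ e) {k σ : ℕ}
    (hk : k ≤ σ) :
    ∏ τ ∈ Finset.range k, ‖((e * σ + f : ℤ) : ℚ_[p]) - ((e * τ + f : ℤ) : ℚ_[p])‖ =
      ‖((σ.descFactorial k : ℕ) : ℚ_[p])‖ := by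
  rw [Nat.descFactorial_eq_prod_range, Nat.cast_prod, norm_prod]
  refine Finset.prod_congr rfl fun τ hτ => ?_
  rw [Finset.mem_range] at hτ
  have h1 : ((e * σ + f : ℤ) : ℚ_[p]) - ((e * τ + f : ℤ) : ℚ_[p]) =
      (e : ℚ_[p]) * (((σ - τ : ℕ) : ℤ) : ℚ_[p]) := by
    push_cast [Nat.cast_sub (by omega : τ ≤ σ)]
    ring
  rw [h1, norm_mul, padic_norm_intCast_eq_one he, one_mul]
  norm_cast

/-- **Yu 1989, Lemma 1.4 (`p`-adic extrapolation), integer nodes, Newton form.** Let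
`G_b(z) = ∑ bₙ zⁿ` over `ℚ_p` with `‖bₙ‖ ρⁿ ≤ B` for some `ρ > 1`, and let the nodes be an
arithmetic progression of integers `a_σ = eσ + f` (`σ < S`) with `p ∤ e` (e.g. all integers `< S`,
or the odd integers — Yu's nodes `s`, `(s, q) = 1`, for `q = 2`). If all jets of order `< M` of
`G_b` at the nodes have norm `≤ ε`, then for every `z ∈ ℤ_p`-point `‖z‖ ≤ 1`:
`‖G_b(z)‖ ≤ max(ε · ‖(S−1)!‖_p^{−(2M−1)}, (B/ρ^{SM}) · ∏_σ ‖z − a_σ‖^M)`, where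
`‖(S−1)!‖_p^{−1} = p^{ord_p((S−1)!)} ≤ p^{(S−2)/(p−1)}` (Legendre) is Yu's conditioning term
`M ord_p(R!)` — against the gain `ρ^{−SM}` of `SM` zeros counted with multiplicity.
[cite: Yu1989, Lemma 1.4 (p. 117)] -/
theorem norm_tsum_le_max_of_small_jets_int {p : ℕ} [Fact p.Prime] {ρ B ε : ℝ} (hρ : 1 < ρ)
    (hε : 0 ≤ ε) {b : ℕ → ℚ_[p]} (hb : WtBdd ρ B b) {S M : ℕ} {e f : ℤ} (he : ¬ (p : ℤ) ∣ e)
    (hjet : ∀ σ < S, ∀ n < M,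
      ‖∑' m, ((dd ((e * σ + f : ℤ) : ℚ_[p]))^[n] b) m * ((e * σ + f : ℤ) : ℚ_[p]) ^ m‖ ≤ ε)
    {z : ℚ_[p]} (hz : ‖z‖ ≤ 1) :
    ‖∑' m, b m * z ^ m‖ ≤
      max (ε * (‖(((S - 1).factorial : ℕ) : ℚ_[p])‖⁻¹) ^ (2 * M - 1))
        (B / ρ ^ (S * M) * ∏ σ ∈ Finset.range S, ‖z - ((e * σ + f : ℤ) : ℚ_[p])‖ ^ M) := by
  set a : ℕ → ℚ_[p] := fun σ => ((e * σ + f : ℤ) : ℚ_[p]) with ha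
  have he0 : e ≠ 0 := fun h => he (by rw [h]; exact dvd_zero _)
  have hnorm : ∀ σ < S, ‖a σ‖ ≤ 1 := fun σ _ => norm_int_le_one _
  have hinj : ∀ σ < S, ∀ τ < S, σ ≠ τ → a σ ≠ a τ := by
    intro σ _ τ _ hστ h
    apply hστ
    simp only [ha] at h
    have h1 : (e * σ + f : ℤ) = e * τ + f := by exact_mod_cast h
    have h2 : (e * σ : ℤ) = e * τ := by linarith
    exact_mod_cast mul_left_cancel₀ he0 h2
  -- hypothesis (H): binomial integrality
  have hH : ∀ τ σ, τ < σ → σ < S →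
      ∏ τ' ∈ Finset.range τ, ‖a σ - a τ'‖ ≤ ∏ τ' ∈ Finset.range τ, ‖a τ - a τ'‖ := by
    intro τ σ hτσ _
    simp only [ha]
    rw [prod_norm_sub_ap he hτσ.le, prod_norm_sub_ap he le_rfl, Nat.descFactorial_self]
    exact padic_norm_natCast_le_of_dvd (Nat.factorial_dvd_descFactorial σ τ)
  -- the conditioning constant
  set C : ℝ := (‖(((S - 1).factorial : ℕ) : ℚ_[p])‖⁻¹) ^ (2 * M - 1) with hC
  have hfacpos : ∀ n : ℕ, 0 < ‖((n.factorial : ℕ) : ℚ_[p])‖ := fun n =>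
    norm_pos_iff.mpr (by exact_mod_cast n.factorial_ne_zero)
  have hC0 : 0 ≤ C := by positivity
  have hCσ : ∀ σ < S, (∏ τ' ∈ Finset.range σ, ‖a σ - a τ'‖ ^ (2 * M - 1))⁻¹ ≤ C := by
    intro σ hσ
    simp only [ha]
    rw [Finset.prod_pow, prod_norm_sub_ap he le_rfl, Nat.descFactorial_self, ← inv_pow, hC]
    refine pow_le_pow_left₀ (inv_nonneg.mpr (norm_nonneg _)) ?_ _
    rw [inv_le_inv₀ (hfacpos σ) (hfacpos (S - 1))]
    exact padic_norm_natCast_le_of_dvd (Nat.factorial_dvd_factorial (by omega))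
  have h := norm_tsum_le_max_of_small_jets_blocks (lt_trans one_pos hρ) hρ le_rfl hε hb
    hnorm hinj hH hjet hC0 hCσ hz
  simpa only [ha] using h

/-- The same with the remainder term simplified (`∏ ‖z − a_σ‖^M ≤ 1`) and the conditioning written
as a power of `p`: `‖G_b(z)‖ ≤ max(ε · p^{(2M−1) ord_p((S−1)!)}, B/ρ^{SM})`.
[cite: Yu1989, Lemma 1.4 (p. 117)] -/
theorem norm_tsum_le_max_of_small_jets_int' {p : ℕ} [Fact p.Prime] {ρ B ε : ℝ} (hρ : 1 < ρ)
    (hε : 0 ≤ ε) {b : ℕ → ℚ_[p]} (hb : WtBdd ρ B b) {S M : ℕ} {e f : ℤ} (he : ¬ (p : ℤ) ∣ e)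
    (hjet : ∀ σ < S, ∀ n < M,
      ‖∑' m, ((dd ((e * σ + f : ℤ) : ℚ_[p]))^[n] b) m * ((e * σ + f : ℤ) : ℚ_[p]) ^ m‖ ≤ ε)
    {z : ℚ_[p]} (hz : ‖z‖ ≤ 1) :
    ‖∑' m, b m * z ^ m‖ ≤
      max (ε * (p : ℝ) ^ ((2 * M - 1) * padicValNat p (S - 1).factorial)) (B / ρ ^ (S * M)) := by
  have h := norm_tsum_le_max_of_small_jets_int hρ hε hb he hjet hz
  rw [inv_padic_norm_factorial, ← pow_mul, mul_comm (padicValNat p _)] at h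
  refine h.trans (max_le_max le_rfl ?_)
  have hB : 0 ≤ B := hb.nonneg
  have hprod : ∏ σ ∈ Finset.range S, ‖z - ((e * σ + f : ℤ) : ℚ_[p])‖ ^ M ≤ 1 := by
    refine Finset.prod_le_one (fun _ _ => by positivity) fun σ _ => pow_le_one₀ (norm_nonneg _) ?_
    have := norm_add_le_max z (-((e * σ + f : ℤ) : ℚ_[p]))
    rw [norm_neg, ← sub_eq_add_neg] at this
    exact this.trans (max_le hz (norm_int_le_one _))
  calc B / ρ ^ (S * M) * ∏ σ ∈ Finset.range S, ‖z - ((e * σ + f : ℤ) : ℚ_[p])‖ ^ M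
      ≤ B / ρ ^ (S * M) * 1 :=
        mul_le_mul_of_nonneg_left hprod (div_nonneg hB (pow_nonneg (by linarith) _))
    _ = B / ρ ^ (S * M) := mul_one _

end PadicNewton

end Literature.NumberTheory.Transcendental

end
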